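import Mathlib
import HarnessLib
import Summits.MatrixMultiplication.MatrixMultiplication.Theorems.OutsiderSandwichToricCeilingPowMixedStar
import Summits.MatrixMultiplication.MatrixMultiplication.Theorems.OutsiderSandwichToricCeilingPowMixedBase

/-!
# OutsiderSandwich — toric ceilings of `cw₂^{⊠N}`: THE STAR LEMMA WITH TWO cw COORDINATES
(decomp-mm lens 4, gen 47, kernel K47-1; THESES-FREE, `ω`-free; helper toward `LaserTangency`,
stmt-32268 — the extremal subrank/packing cells of the literal host `kroneckerPow (cwTensor ℂ 2) N`)

LABEL.  TORIC · uniform in `N` · NEC-side instrument of the decomposition cell; the rates / the crux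
`h₁ = LaserTangency` and the route's `closes` are untouched.  By itself it decides no toric value:
it is input (a) of NODE-g46 §5 (decomp-mm lens 4) — «`hasPM_star` for tails with two cw
coordinates» — the star input of ANY co-size-2 slice engine (`…PowMixedCrossed`, `…PowMixedSpread`
consume stars in the slots next to the pivot) in product bases with two Coppersmith–Winograd
coordinates, where `…PowMixedStar.hasPM_star` (at most ONE cw coordinate) does not reach.

WHAT.  `hasPM_star_two`: for EVERY `N` and every flag word `κ : Fin N → Bool` (`true` = cw basis,
`false` = permutation basis at that coordinate) with AT MOST TWO cw coordinates (inline hypothesis: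
among any three cw coordinates two coincide), the complement of any STAR `({x}, {y}, {z})` whose
letters `xᵢ, yᵢ, zᵢ` are pairwise distinct at every coordinate has a leg-injective perfect
matching inside `frame κ` (`isPMκ`, `…PowMixedGlue`).

HOW.  The induction of `…PowMixedStar` verbatim — slice at a permutation pivot (`star_slice`, which
needs no hypothesis on the number of cw coordinates) while there is one — down to the all-cw frames,
which under the hypothesis have `N ≤ 2`: `N = 0` (`star_zero`), `N = 1` (`star_cw_one`, the two-row
table of K46-2b) and the NEW BASE `N = 2` (`star_cw_two`): the `36` distinct-letter stars of the
`cw ⊠ cw` frame, each matched by eight coded rows found by a depth-first matcher and confirmed by an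
independent Boolean checker in the kernel (`starCensus`, `decide`; coding `enc/dec` and the bridge
lemmas `injOn_leg`, `card_word_two` of K46-7 `…PowMixedBase`, checker → `isPMκ` by
`isPMκ_of_validStar`).  DATA (not formalised, NODE-g47 §3): the `6³ = 216` distinct-letter stars of
`cw^{⊠3}` and all stars of every product basis with `N ≤ 3` are matchable too, so the restriction
«two» is where the kernel bases stop, not where the lemma is expected to fail.
All definitions are letter tables / list programs run by `decide`; no new axioms.
-/

set_option linter.dupNamespace false

namespace Summit.MatrixMultiplication.MatrixMultiplication.Theorems.OutsiderSandwichToricCeilingPowTwoCwStar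

open Finset
open Summit.MatrixMultiplication.MatrixMultiplication.Theorems.OutsiderSandwichToricCeiling
  (cwSlot dSlot)
open Summit.MatrixMultiplication.MatrixMultiplication.Theorems.OutsiderSandwichToricCeilingPowFibres
  (Word Tr3 slotB frame)
open Summit.MatrixMultiplication.MatrixMultiplication.Theorems.OutsiderSandwichToricCeilingPowMixedGlue
open Summit.MatrixMultiplication.MatrixMultiplication.Theorems.OutsiderSandwichToricCeilingPowMixedStar
  (star_slice star_zero star_cw_one)
open Summit.MatrixMultiplication.MatrixMultiplication.Theorems.OutsiderSandwichToricCeilingPowMixedBase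
  (W T enc dec dec3 dec_enc enc_dec dec_injective allW third injOn_leg card_word_two)

variable {m : ℕ}

/-! ## §1 At most two cw coordinates (inline hypothesis, inherited by tails) -/

/-- The tail of a flag word with at most two cw coordinates has at most two cw coordinates. -/
theorem tailκ_atMostTwo {p : Fin (m + 1)} {κ : Fin (m + 1) → Bool}
    (hκ : ∀ i j k, κ i = true → κ j = true → κ k = true → i = j ∨ j = k ∨ i = k) :
    ∀ i j k, tailκ p κ i = true → tailκ p κ j = true → tailκ p κ k = true →
      i = j ∨ j = k ∨ i = k := by
  intro i j k hi hj hk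
  rw [tailκ_apply] at hi hj hk
  rcases hκ _ _ _ hi hj hk with h | h | h
  · exact Or.inl (Fin.succAbove_right_injective h)
  · exact Or.inr (Or.inl (Fin.succAbove_right_injective h))
  · exact Or.inr (Or.inr (Fin.succAbove_right_injective h))

/-- An all-cw flag word with at most two cw coordinates has length at most two. -/
theorem le_two_of_all {n : ℕ} {κ : Fin n → Bool}
    (hκ : ∀ i j k, κ i = true → κ j = true → κ k = true → i = j ∨ j = k ∨ i = k)
    (hall : ∀ i, κ i = true) : n ≤ 2 := by
  by_contra hn
  push Not at hn
  have h := hκ ⟨0, by omega⟩ ⟨1, by omega⟩ ⟨2, by omega⟩ (hall _) (hall _) (hall _)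
  simp [Fin.ext_iff] at h

/-! ## §2 The `cw ⊠ cw` star census (coded words, run by `decide`) -/

/-- The third coded word of a row of the frame `cw ⊠ cw` with first two coded words `a, v`, if
any (search heuristic only; rows are re-checked by `validStar`). [new] -/
def third2cc (a v : W) : Option W :=
  match third true a.1 v.1, third true a.2 v.2 with
  | some c₀, some c₁ => some (c₀, c₁)
  | _, _ => none

/-- Depth-first search for a perfect matching of the `cw ⊠ cw` frame on the given vertex lists
(fuel = number of `A`-vertices `+ 1`). [new] -/
def searchCC : ℕ → List W → List W → List W → Option (List T)
  | 0, _, _, _ => none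
  | _ + 1, [], _, _ => some []
  | n + 1, a :: as, bs, cs =>
    bs.findSome? fun v =>
      match third2cc a v with
      | none => none
      | some c =>
        if cs.contains c then
          ((searchCC n as (bs.erase v) (cs.erase c)).map fun M => (a, v, c) :: M)
        else none

/-- A coded row lies in the frame `cw ⊠ cw`. [new] -/
def rowCC (t : T) : Bool :=
  slotB true t.1.1 t.2.1.1 t.2.2.1 && slotB true t.1.2 t.2.1.2 t.2.2.2

/-- CHECKER: `M` is a perfect matching of the frame `cw ⊠ cw` minus the coded star `(x, y, z)` —
eight frame rows avoiding the removed vertices, with pairwise distinct legs. [new] -/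
def validStar (x y z : W) (M : List T) : Bool :=
  (M.all fun t => rowCC t && decide (t.1 ≠ x ∧ t.2.1 ≠ y ∧ t.2.2 ≠ z)) &&
  decide ((M.map fun t => t.1).Nodup ∧ (M.map fun t => t.2.1).Nodup ∧
    (M.map fun t => t.2.2).Nodup ∧ M.length = 8)

/-- The vertices of one leg: all codes but the removed one. [new] -/
def verts1 (x : W) : List W := allW.filter fun w => decide (w ≠ x)

/-- The coded star `(x, y, z)` is matchable, as certified by `searchCC` + `validStar`. [new] -/
def goodStar (x y z : W) : Bool :=
  match searchCC 9 (verts1 x) (verts1 y) (verts1 z) with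
  | none => false
  | some M => validStar x y z M

/-- The coded star has pairwise distinct letters at both coordinates. [new] -/
def distinct2 (x y z : W) : Bool :=
  decide (x.1 ≠ y.1 ∧ y.1 ≠ z.1 ∧ x.1 ≠ z.1 ∧ x.2 ≠ y.2 ∧ y.2 ≠ z.2 ∧ x.2 ≠ z.2)

set_option maxHeartbeats 8000000 in
/-- THE CENSUS (kernel): each of the `36` distinct-letter stars of `cw ⊠ cw` is matchable. -/
theorem starCensus : (allW.all fun x => allW.all fun y => allW.all fun z =>
    !distinct2 x y z || goodStar x y z) = true := by
  decide

/-- Every code is listed. -/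
theorem mem_allW : ∀ u : W, u ∈ allW := by
  decide

/-- A distinct-letter coded star is certified matchable by the census. -/
theorem goodStar_of_distinct {x y z : W} (h : distinct2 x y z = true) : goodStar x y z = true := by
  have hc := List.all_eq_true.1 (List.all_eq_true.1 (List.all_eq_true.1 starCensus x (mem_allW x))
    y (mem_allW y)) z (mem_allW z)
  simpa [h] using hc

/-- `goodStar` unfolded: the matcher returned a list accepted by the checker. -/
theorem exists_validStar {x y z : W} (hg : goodStar x y z = true) :
    ∃ M, validStar x y z M = true := by
  unfold goodStar at hg
  split at hg
  · exact absurd hg Bool.false_ne_true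
  · exact ⟨_, hg⟩

/-! ## §3 From the checker to `isPMκ` -/

/-- A checked coded row decodes to a row of the frame `cw ⊠ cw`. -/
theorem dec3_mem_frameCC {t : T} (ht : rowCC t = true) :
    dec3 t ∈ frame (fun _ : Fin 2 => true) := by
  rw [rowCC, Bool.and_eq_true] at ht
  rw [mem_frame, Fin.forall_fin_two]
  exact ht

/-- A leg image of the decoded rows is the complement of the removed word: it avoids the word and
has eight elements. -/
theorem image_leg1 {M : List T} {f : T → W} {g : Tr3 2 → Word 2} (hfg : ∀ t, g (dec3 t) = dec (f t))
    (hn : (M.map f).Nodup) (hlen : M.length = 8) {x : Word 2} (havoid : ∀ t ∈ M, f t ≠ enc x) :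
    (M.map dec3).toFinset.image g = univ \ {x} := by
  apply Finset.eq_of_subset_of_card_le
  · intro w hw
    rw [Finset.mem_image] at hw
    obtain ⟨u, hu, rfl⟩ := hw
    rw [List.mem_toFinset, List.mem_map] at hu
    obtain ⟨s, hs, rfl⟩ := hu
    rw [hfg, Finset.mem_sdiff, Finset.mem_singleton]
    exact ⟨Finset.mem_univ _, fun h => havoid s hs (by rw [← enc_dec (f s), h])⟩
  · have himg : (M.map dec3).toFinset.image g = ((M.map f).map dec).toFinset := by
      ext w
      rw [Finset.mem_image, List.mem_toFinset, List.mem_map]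
      constructor
      · rintro ⟨u, hu, rfl⟩
        rw [List.mem_toFinset, List.mem_map] at hu
        obtain ⟨s, hs, rfl⟩ := hu
        exact ⟨f s, List.mem_map.2 ⟨s, hs, rfl⟩, (hfg s).symm⟩
      · rintro ⟨a, ha, rfl⟩
        rw [List.mem_map] at ha
        obtain ⟨s, hs, rfl⟩ := ha
        exact ⟨dec3 s, List.mem_toFinset.2 (List.mem_map.2 ⟨s, hs, rfl⟩), hfg s⟩
    rw [Finset.card_univ_sdiff, Finset.card_singleton, card_word_two, himg,
      List.toFinset_card_of_nodup (hn.map dec_injective), List.length_map, List.length_map, hlen]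

/-- **BRIDGE.**  A list accepted by the checker decodes to a perfect matching (`isPMκ`) of the
frame `cw ⊠ cw` minus the star `({x}, {y}, {z})`. -/
theorem isPMκ_of_validStar {x y z : Word 2} {M : List T}
    (hv : validStar (enc x) (enc y) (enc z) M = true) :
    isPMκ (fun _ : Fin 2 => true) (M.map dec3).toFinset {x} {y} {z} = true := by
  simp only [validStar, Bool.and_eq_true, List.all_eq_true, decide_eq_true_eq] at hv
  obtain ⟨hrow, hn₁, hn₂, hn₃, hlen⟩ := hv
  refine isPMκ_iff.2 ⟨?_, injOn_leg (f := fun t => t.1) (fun _ => rfl) hn₁,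
    injOn_leg (f := fun t => t.2.1) (fun _ => rfl) hn₂,
    injOn_leg (f := fun t => t.2.2) (fun _ => rfl) hn₃,
    image_leg1 (f := fun t => t.1) (fun _ => rfl) hn₁ hlen fun t ht => (hrow t ht).2.1,
    image_leg1 (f := fun t => t.2.1) (fun _ => rfl) hn₂ hlen fun t ht => (hrow t ht).2.2.1,
    image_leg1 (f := fun t => t.2.2) (fun _ => rfl) hn₃ hlen fun t ht => (hrow t ht).2.2.2⟩
  intro u hu
  rw [List.mem_toFinset, List.mem_map] at hu
  obtain ⟨s, hs, rfl⟩ := hu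
  exact dec3_mem_frameCC (hrow s hs).1

/-! ## §4 The base `N = 2` and the star lemma -/

/-- **BASE `cw ⊠ cw`.**  The complement of a distinct-letter star in the frame `cw ⊠ cw` has a
perfect matching (the `36` stars of the census `starCensus`). [TORIC · N = 2 · kernel census] -/
theorem star_cw_two (x y z : Word 2) (h : ∀ i, x i ≠ y i ∧ y i ≠ z i ∧ x i ≠ z i) :
    ∃ P, isPMκ (fun _ : Fin 2 => true) P {x} {y} {z} = true := by
  have hd : distinct2 (enc x) (enc y) (enc z) = true := by
    simp only [distinct2, enc, decide_eq_true_eq]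
    exact ⟨(h 0).1, (h 0).2.1, (h 0).2.2, (h 1).1, (h 1).2.1, (h 1).2.2⟩
  obtain ⟨M, hv⟩ := exists_validStar (goodStar_of_distinct hd)
  exact ⟨_, isPMκ_of_validStar hv⟩

/-- **THE STAR LEMMA WITH AT MOST TWO cw COORDINATES** (all `N`).  For every flag word `κ` with
at most two cw coordinates, the complement of a star `({x}, {y}, {z})` with pairwise distinct
letters at every coordinate has a leg-injective perfect matching inside `frame κ`.  Induction on
`N`: slice at a permutation pivot (`…PowMixedStar.star_slice`) if there is one; otherwise every
coordinate is cw, so `N ≤ 2`, and the bases `star_zero`, `star_cw_one`, `star_cw_two` apply.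
[TORIC · uniform in N · NEC-side instrument; the rates of `h₁ = LaserTangency` untouched] -/
theorem hasPM_star_two : ∀ (m : ℕ) (κ : Fin m → Bool),
    (∀ i j k, κ i = true → κ j = true → κ k = true → i = j ∨ j = k ∨ i = k) →
    ∀ x y z : Word m, (∀ i, x i ≠ y i ∧ y i ≠ z i ∧ x i ≠ z i) →
      ∃ P, isPMκ κ P {x} {y} {z} = true := by
  intro m
  induction m with
  | zero => exact fun κ _ x y z _ => ⟨∅, star_zero κ x y z⟩
  | succ m IH =>
    intro κ hκ x y z h
    by_cases hD : ∃ p, κ p = false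
    · obtain ⟨p, hp⟩ := hD
      exact star_slice hp (IH (tailκ p κ) (tailκ_atMostTwo hκ)) h
    · push Not at hD
      have hall : ∀ i, κ i = true := fun i => by simpa using hD i
      have hle : m + 1 ≤ 2 := le_two_of_all hκ hall
      obtain rfl : κ = fun _ => true := funext hall
      rcases m with _ | _ | m
      · exact star_cw_one x y z h
      · exact star_cw_two x y z h
      · omega

/-- The one-cw star lemma of K46-2b is the special case «at most one cw coordinate» (consistency
check; not used). -/
theorem hasPM_star_two_of_atMostOne (κ : Fin m → Bool)
    (hκ : ∀ i j, κ i = true → κ j = true → i = j) (x y z : Word m)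
    (h : ∀ i, x i ≠ y i ∧ y i ≠ z i ∧ x i ≠ z i) : ∃ P, isPMκ κ P {x} {y} {z} = true :=
  hasPM_star_two m κ (fun i j _ hi hj _ => Or.inl (hκ i j hi hj)) x y z h

end Summit.MatrixMultiplication.MatrixMultiplication.Theorems.OutsiderSandwichToricCeilingPowTwoCwStar
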